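import Mathlib.RingTheory.Ideal.Span
import Mathlib.RingTheory.PrincipalIdealDomain
import Mathlib.Tactic.LinearCombination
import Mathlib.Tactic.Ring
import HarnessLib

/-!
# Monomials in two non-associated primes of a domain

Topic: `Literature/RingTheory/UniqueFactorizationDomain` (support for the discharge of
`Literature.Barriers.ResolutionOfSingularities.Cutkosky.CutkoskyMonomialPersists`): in an
integral domain with two prime elements `π₀, π₁`, neither dividing the other — e.g. a regular
system of parameters `y₁, y₂` of a two-dimensional regular local ring — (i) every divisor of a
monomial `π₀ᵃ π₁ᵇ` is a unit times a smaller monomial, (ii) `π₀ᵍ π₁ʰ ∉ (π₀ᵍ⁺¹, π₁ʰ⁺¹)`, hence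
(iii) a monomial lies in the ideal generated by two monomials only if it is a multiple of one of
them. All [folklore]; PROVED.
-/

namespace Literature.RingTheory.UniqueFactorizationDomain

variable {S : Type*} [CommRing S] [IsDomain S] {π₀ π₁ : S}

/-- **Divisors of `π₀ᵃ π₁ᵇ` are unit multiples of smaller monomials.** [folklore] -/
theorem exists_eq_unit_mul_of_dvd (h₀ : Prime π₀) (h₁ : Prime π₁) :
    ∀ (a b : ℕ) (q : S), q ∣ π₀ ^ a * π₁ ^ b →
      ∃ (u : Sˣ) (g h : ℕ), g ≤ a ∧ h ≤ b ∧ q = u * π₀ ^ g * π₁ ^ h := by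
  intro a
  induction a with
  | zero =>
    intro b
    induction b with
    | zero =>
      intro q hq
      rw [pow_zero, pow_zero, mul_one] at hq
      obtain ⟨u, rfl⟩ := isUnit_of_dvd_one hq
      exact ⟨u, 0, 0, le_rfl, le_rfl, by simp⟩
    | succ b ih =>
      intro q hq
      obtain ⟨c, hc⟩ := hq
      have hdvd : π₁ ∣ q * c := ⟨π₀ ^ 0 * π₁ ^ b, by rw [← hc]; ring⟩
      rcases h₁.dvd_or_dvd hdvd with ⟨q', rfl⟩ | ⟨c', rfl⟩
      · have hq' : q' ∣ π₀ ^ 0 * π₁ ^ b := ⟨c, mul_left_cancel₀ h₁.ne_zero (by linear_combination hc)⟩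
        obtain ⟨u, g, h, hg, hh, rfl⟩ := ih q' hq'
        exact ⟨u, g, h + 1, hg, Nat.succ_le_succ hh, by ring⟩
      · have hq' : q ∣ π₀ ^ 0 * π₁ ^ b := ⟨c', mul_left_cancel₀ h₁.ne_zero (by linear_combination hc)⟩
        obtain ⟨u, g, h, hg, hh, rfl⟩ := ih q hq'
        exact ⟨u, g, h, hg, hh.trans (Nat.le_succ _), rfl⟩
  | succ a iha =>
    intro b q hq
    obtain ⟨c, hc⟩ := hq
    have hdvd : π₀ ∣ q * c := ⟨π₀ ^ a * π₁ ^ b, by rw [← hc]; ring⟩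
    rcases h₀.dvd_or_dvd hdvd with ⟨q', rfl⟩ | ⟨c', rfl⟩
    · have hq' : q' ∣ π₀ ^ a * π₁ ^ b := ⟨c, mul_left_cancel₀ h₀.ne_zero (by linear_combination hc)⟩
      obtain ⟨u, g, h, hg, hh, rfl⟩ := iha b q' hq'
      exact ⟨u, g + 1, h, Nat.succ_le_succ hg, hh, by ring⟩
    · have hq' : q ∣ π₀ ^ a * π₁ ^ b := ⟨c', mul_left_cancel₀ h₀.ne_zero (by linear_combination hc)⟩
      obtain ⟨u, g, h, hg, hh, rfl⟩ := iha b q hq'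
      exact ⟨u, g, h, hg.trans (Nat.le_succ _), hh, rfl⟩

/-- **`π₀ᵍ π₁ʰ ∉ (π₀ᵍ⁺¹, π₁ʰ⁺¹)`** for non-associated primes generating a proper ideal (e.g. in a
local ring). [folklore] -/
theorem pow_mul_pow_not_mem_span (h₀ : Prime π₀) (h₁ : Prime π₁) (h01 : ¬ π₀ ∣ π₁) (h10 : ¬ π₁ ∣ π₀)
    (hproper : Ideal.span ({π₀, π₁} : Set S) ≠ ⊤) :
    ∀ g h : ℕ, π₀ ^ g * π₁ ^ h ∉ Ideal.span ({π₀ ^ (g + 1), π₁ ^ (h + 1)} : Set S) := by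
  -- induction on `g + h`
  suffices H : ∀ n g h, g + h = n → π₀ ^ g * π₁ ^ h ∉ Ideal.span ({π₀ ^ (g + 1), π₁ ^ (h + 1)} : Set S) from
    fun g h => H _ g h rfl
  intro n
  induction n with
  | zero =>
    intro g h hgh hmem
    obtain ⟨rfl, rfl⟩ : g = 0 ∧ h = 0 := by omega
    simp only [pow_zero, mul_one, zero_add, pow_one] at hmem
    exact hproper ((Ideal.eq_top_iff_one _).mpr hmem)
  | succ n ih =>
    intro g h hgh hmem
    rw [Ideal.mem_span_pair] at hmem
    obtain ⟨A, B, hAB⟩ := hmem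
    rcases Nat.eq_zero_or_pos g with hg | hg
    · -- `g = 0`, `h = n + 1 > 0`: `π₁ ∣ A π₀`, so `π₁ ∣ A`
      subst hg
      have hh : 0 < h := by omega
      have hdvd : π₁ ∣ A * π₀ ^ 1 := by
        refine ⟨π₀ ^ 0 * π₁ ^ (h - 1) - B * π₁ ^ h, ?_⟩
        have : π₁ ^ h = π₁ * π₁ ^ (h - 1) := by rw [← pow_succ', Nat.sub_add_cancel hh]
        have e2 : π₁ ^ (h + 1) = π₁ * π₁ ^ h := by rw [pow_succ']
        rw [this] at hAB; rw [e2] at hAB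
        linear_combination hAB
      have hA : π₁ ∣ A := by
        rcases h₁.dvd_or_dvd hdvd with hA | hA
        · exact hA
        · exact absurd (h₁.dvd_of_dvd_pow hA) h10
      obtain ⟨A', rfl⟩ := hA
      apply ih 0 (h - 1) (by omega)
      rw [Ideal.mem_span_pair]
      refine ⟨A', B, mul_left_cancel₀ h₁.ne_zero ?_⟩
      have : π₁ ^ h = π₁ * π₁ ^ (h - 1) := by rw [← pow_succ', Nat.sub_add_cancel hh]
      have e2 : π₁ ^ (h + 1) = π₁ * π₁ ^ h := by rw [pow_succ']
      rw [Nat.sub_add_cancel hh]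
      rw [this, e2] at hAB
      linear_combination hAB
    · -- `g > 0`: `π₀ ∣ B π₁^{h+1}`, so `π₀ ∣ B`
      have hdvd : π₀ ∣ B * π₁ ^ (h + 1) := by
        refine ⟨π₀ ^ (g - 1) * π₁ ^ h - A * π₀ ^ g, ?_⟩
        have : π₀ ^ g = π₀ * π₀ ^ (g - 1) := by rw [← pow_succ', Nat.sub_add_cancel hg]
        have e2 : π₀ ^ (g + 1) = π₀ * π₀ ^ g := by rw [pow_succ']
        rw [this] at hAB; rw [e2] at hAB
        linear_combination hAB
      have hB : π₀ ∣ B := by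
        rcases h₀.dvd_or_dvd hdvd with hB | hB
        · exact hB
        · exact absurd (h₀.dvd_of_dvd_pow hB) h01
      obtain ⟨B', rfl⟩ := hB
      apply ih (g - 1) h (by omega)
      rw [Ideal.mem_span_pair]
      refine ⟨A, B', mul_left_cancel₀ h₀.ne_zero ?_⟩
      have : π₀ ^ g = π₀ * π₀ ^ (g - 1) := by rw [← pow_succ', Nat.sub_add_cancel hg]
      have e2 : π₀ ^ (g + 1) = π₀ * π₀ ^ g := by rw [pow_succ']
      rw [Nat.sub_add_cancel hg]
      rw [this, e2] at hAB
      linear_combination hAB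

/-- **Monomial ideal membership**: if `π₀ᵍ π₁ʰ ∈ (π₀ᵃ π₁ᵇ, π₀ᶜ π₁ᵈ)` then `(a, b) ≤ (g, h)` or
`(c, d) ≤ (g, h)`. [folklore] -/
theorem le_or_le_of_pow_mul_pow_mem_span (h₀ : Prime π₀) (h₁ : Prime π₁) (h01 : ¬ π₀ ∣ π₁)
    (h10 : ¬ π₁ ∣ π₀) (hproper : Ideal.span ({π₀, π₁} : Set S) ≠ ⊤) {a b c d g h : ℕ}
    (hmem : π₀ ^ g * π₁ ^ h ∈ Ideal.span ({π₀ ^ a * π₁ ^ b, π₀ ^ c * π₁ ^ d} : Set S)) :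
    (a ≤ g ∧ b ≤ h) ∨ (c ≤ g ∧ d ≤ h) := by
  rcases em (a ≤ g ∧ b ≤ h) with hc1 | hc1
  · exact Or.inl hc1
  rcases em (c ≤ g ∧ d ≤ h) with hc2 | hc2
  · exact Or.inr hc2
  exfalso
  rw [Ideal.mem_span_pair] at hmem
  obtain ⟨s, t, hst⟩ := hmem
  -- each generator lies in `(π₀^{g+1})` or `(π₁^{h+1})`
  have hgen1 : s * (π₀ ^ a * π₁ ^ b) ∈ Ideal.span ({π₀ ^ (g + 1), π₁ ^ (h + 1)} : Set S) := by
    rw [Ideal.mem_span_pair]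
    by_cases hag : a ≤ g
    · have hbh : h < b := by omega
      exact ⟨0, s * π₀ ^ a * π₁ ^ (b - (h + 1)), by
        rw [zero_mul, zero_add, mul_assoc, mul_assoc, ← pow_add, Nat.sub_add_cancel hbh]⟩
    · have hag : g + 1 ≤ a := by omega
      exact ⟨s * π₀ ^ (a - (g + 1)) * π₁ ^ b, 0, by
        rw [zero_mul, add_zero]
        calc s * π₀ ^ (a - (g + 1)) * π₁ ^ b * π₀ ^ (g + 1)
            = s * (π₀ ^ (a - (g + 1)) * π₀ ^ (g + 1)) * π₁ ^ b := by ring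
          _ = s * (π₀ ^ a * π₁ ^ b) := by rw [← pow_add, Nat.sub_add_cancel hag]; ring⟩
  have hgen2 : t * (π₀ ^ c * π₁ ^ d) ∈ Ideal.span ({π₀ ^ (g + 1), π₁ ^ (h + 1)} : Set S) := by
    rw [Ideal.mem_span_pair]
    by_cases hcg : c ≤ g
    · have hdh : h < d := by omega
      exact ⟨0, t * π₀ ^ c * π₁ ^ (d - (h + 1)), by
        rw [zero_mul, zero_add, mul_assoc, mul_assoc, ← pow_add, Nat.sub_add_cancel hdh]⟩
    · have hcg : g + 1 ≤ c := by omega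
      exact ⟨t * π₀ ^ (c - (g + 1)) * π₁ ^ d, 0, by
        rw [zero_mul, add_zero]
        calc t * π₀ ^ (c - (g + 1)) * π₁ ^ d * π₀ ^ (g + 1)
            = t * (π₀ ^ (c - (g + 1)) * π₀ ^ (g + 1)) * π₁ ^ d := by ring
          _ = t * (π₀ ^ c * π₁ ^ d) := by rw [← pow_add, Nat.sub_add_cancel hcg]; ring⟩
  apply pow_mul_pow_not_mem_span h₀ h₁ h01 h10 hproper g h
  rw [← hst]
  exact Ideal.add_mem _ hgen1 hgen2

end Literature.RingTheory.UniqueFactorizationDomain
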